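import Literature.Probability.Moments.FiniteTiltGaussianLimit
import Literature.Probability.Distributions.GaussianMoments
import HarnessLib

/-!
# Moments and two-sided deviations of a finitely supported statistic from a uniform quadratic expansion

Model-free companion of `FiniteTiltGaussianLimit.lean` (UQE ⇒ Gaussian mgf limit ⇒ CLT) and `FiniteTiltModerateDeviations.lean` (UQE ⇒ MDP), closing the
engine trilogy: under the UNIFORM QUADRATIC EXPANSION of the log-Laplace transform of `(X_n − c_n)/a_n` with curvature `H`,

* §1 ★★ `tendsto_integral_pow_of_uqe` — for probability measures `μ_n` whose mgf is the tilt ratio, EVERY moment `∫ x^k dμ_n` converges to the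
  `k`-th moment of `N(0,H)` (Curtiss' moment theorem `tendsto_integral_pow_of_tendsto_mgf` on `tendsto_tiltRatio_of_uqe`);
  `tendsto_integral_pow_even_of_uqe` (`→ H^r (2r−1)‼`), `tendsto_integral_pow_odd_of_uqe` (`→ 0`): asymptotic skewness `0` and kurtosis `3` for every such
  statistic (the lane's CAR 41 «GAUSSIAN MOMENTS» per statistic becomes an instance).
* §2 ★★ `tendsto_log_twoSidedTail_div_sq_of_uqe` — THE TWO-SIDED MODERATE DEVIATION PRINCIPLE
  `ξ_n^{-2} log P_n(|X_n − c_n| ≥ ξ_n a_n) → −1/(2H)` (the two one-sided principles of `FiniteTiltModerateDeviations` and `log 2/ξ_n² → 0`).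

## Sources
J. H. Curtiss (1942) Theorem 3; S. Janson, *Gaussian Hilbert Spaces* (1997) Rem. 1.30 (Gaussian moments); A. Dembo, O. Zeitouni (2010) §3.7 (lane
statements).  The packaging is this lineage's (lane «pcv-sawmu», a-p5 g27); nothing is quoted AS PRINTED.
-/

noncomputable section

open MeasureTheory ProbabilityTheory Filter Set Finset
open Literature.Probability.Distributions
open scoped Topology Nat

namespace Literature.Probability.Moments

/-! ## §1 ★★ All moments converge to the Gaussian moments -/

open Classical in
/-- ★★ **ALL MOMENTS FROM A UQE.**  Let `μ_n` be probability measures on `ℝ` whose moment generating functions are the tilt ratios of a finite family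
with nonnegative weights of positive mass (the law of `(X_n − c_n)/a_n` under `P_n`), all exponential moments integrable, and suppose the family satisfies the
uniform quadratic expansion with curvature `H ≥ 0`, `a_n → ∞`.  Then `∫ x^k dμ_n → ∫ x^k dN(0,H)` for every `k`.
[cite: Curtiss1942, Theorem 3 (moment theorem); DemboZeitouni2010, §2.3 (lane statement)] -/
theorem tendsto_integral_pow_of_uqe {ι : Type*} (S : ℕ → Finset ι) (w X : ℕ → ι → ℝ) (a c : ℕ → ℝ) (H : NNReal)
    {μ : ℕ → Measure ℝ}
    (hw : ∀ᶠ n in atTop, ∀ i ∈ S n, 0 ≤ w n i) (hZ : ∀ᶠ n in atTop, 0 < ∑ i ∈ S n, w n i) (ha : Tendsto a atTop atTop)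
    (hU : ∀ η : ℝ, 0 < η → ∃ δ : ℝ, 0 < δ ∧ ∀ᶠ n in atTop, ∀ s : ℝ, |s| ≤ δ * a n →
      |Real.log ((∑ i ∈ S n, w n i * Real.exp (s / a n * X n i)) / ∑ i ∈ S n, w n i) - s * c n / a n - (H : ℝ) * s ^ 2 / 2| ≤ η * s ^ 2 + η)
    (hint : ∀ s : ℝ, ∀ n, Integrable (fun x => Real.exp (s * x)) (μ n))
    (hmgf : ∀ s : ℝ, ∀ᶠ n in atTop,
      ∫ x, Real.exp (s * x) ∂μ n = (∑ i ∈ S n, w n i * Real.exp (s / a n * X n i)) / (∑ i ∈ S n, w n i) * Real.exp (-(s * c n / a n)))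
    (k : ℕ) :
    Tendsto (fun n => ∫ x, x ^ k ∂μ n) atTop (𝓝 (∫ x, x ^ k ∂gaussianReal 0 H)) := by
  refine tendsto_integral_pow_of_tendsto_mgf (ν := gaussianReal 0 H) one_pos (fun s _ n => hint s n)
    (fun s _ => integrable_exp_mul_gaussianReal s) (fun s _ => ?_) k
  have hG : ∫ x, Real.exp (s * x) ∂gaussianReal 0 H = Real.exp ((H : ℝ) * s ^ 2 / 2) := by
    have h := congrFun (mgf_id_gaussianReal (μ := 0) (v := H)) s
    simp only [mgf, id_eq] at h
    rw [h, zero_mul, zero_add]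
  rw [hG]
  exact (tendsto_tiltRatio_of_uqe S w X a c (H : ℝ) hw hZ ha hU s).congr' ((hmgf s).mono fun n hn => hn.symm)

open Classical in
/-- ★★ **Even moments**: under the same hypotheses `∫ x^{2r} dμ_n → H^r·(2r−1)‼`. [cite: Janson1997, Rem. 1.30 (Gaussian moments); Curtiss1942, Theorem 3] -/
theorem tendsto_integral_pow_even_of_uqe {ι : Type*} (S : ℕ → Finset ι) (w X : ℕ → ι → ℝ) (a c : ℕ → ℝ) (H : NNReal)
    {μ : ℕ → Measure ℝ}
    (hw : ∀ᶠ n in atTop, ∀ i ∈ S n, 0 ≤ w n i) (hZ : ∀ᶠ n in atTop, 0 < ∑ i ∈ S n, w n i) (ha : Tendsto a atTop atTop)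
    (hU : ∀ η : ℝ, 0 < η → ∃ δ : ℝ, 0 < δ ∧ ∀ᶠ n in atTop, ∀ s : ℝ, |s| ≤ δ * a n →
      |Real.log ((∑ i ∈ S n, w n i * Real.exp (s / a n * X n i)) / ∑ i ∈ S n, w n i) - s * c n / a n - (H : ℝ) * s ^ 2 / 2| ≤ η * s ^ 2 + η)
    (hint : ∀ s : ℝ, ∀ n, Integrable (fun x => Real.exp (s * x)) (μ n))
    (hmgf : ∀ s : ℝ, ∀ᶠ n in atTop,
      ∫ x, Real.exp (s * x) ∂μ n = (∑ i ∈ S n, w n i * Real.exp (s / a n * X n i)) / (∑ i ∈ S n, w n i) * Real.exp (-(s * c n / a n)))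
    (r : ℕ) :
    Tendsto (fun n => ∫ x, x ^ (2 * r) ∂μ n) atTop (𝓝 ((H : ℝ) ^ r * ((2 * r - 1 : ℕ)‼ : ℝ))) := by
  have h := tendsto_integral_pow_of_uqe S w X a c H hw hZ ha hU hint hmgf (2 * r)
  rwa [integral_pow_even_gaussianReal] at h

open Classical in
/-- ★★ **Odd moments**: under the same hypotheses `∫ x^{2r+1} dμ_n → 0` (asymptotic symmetry; skewness `→ 0`).
[cite: Janson1997, Rem. 1.30; Curtiss1942, Theorem 3] -/
theorem tendsto_integral_pow_odd_of_uqe {ι : Type*} (S : ℕ → Finset ι) (w X : ℕ → ι → ℝ) (a c : ℕ → ℝ) (H : NNReal)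
    {μ : ℕ → Measure ℝ}
    (hw : ∀ᶠ n in atTop, ∀ i ∈ S n, 0 ≤ w n i) (hZ : ∀ᶠ n in atTop, 0 < ∑ i ∈ S n, w n i) (ha : Tendsto a atTop atTop)
    (hU : ∀ η : ℝ, 0 < η → ∃ δ : ℝ, 0 < δ ∧ ∀ᶠ n in atTop, ∀ s : ℝ, |s| ≤ δ * a n →
      |Real.log ((∑ i ∈ S n, w n i * Real.exp (s / a n * X n i)) / ∑ i ∈ S n, w n i) - s * c n / a n - (H : ℝ) * s ^ 2 / 2| ≤ η * s ^ 2 + η)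
    (hint : ∀ s : ℝ, ∀ n, Integrable (fun x => Real.exp (s * x)) (μ n))
    (hmgf : ∀ s : ℝ, ∀ᶠ n in atTop,
      ∫ x, Real.exp (s * x) ∂μ n = (∑ i ∈ S n, w n i * Real.exp (s / a n * X n i)) / (∑ i ∈ S n, w n i) * Real.exp (-(s * c n / a n)))
    (r : ℕ) :
    Tendsto (fun n => ∫ x, x ^ (2 * r + 1) ∂μ n) atTop (𝓝 0) := by
  have h := tendsto_integral_pow_of_uqe S w X a c H hw hZ ha hU hint hmgf (2 * r + 1)
  rwa [integral_pow_odd_gaussianReal] at h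

/-! ## §2 ★★ The two-sided moderate deviation principle -/

section TwoSided

variable {α ι : Type*} {l : Filter α} (S : α → Finset ι) (w X : α → ι → ℝ) (a c : α → ℝ) (H : ℝ)

/-- (plumbing) A two-sided exponential squeeze with a bounded prefactor gives the limit of `ξ^{-2} log P`.
[cite: DemboZeitouni2010, §3.7 (lane plumbing)] -/
private theorem tendsto_log_div_sq_of_squeeze_two {P ξ : α → ℝ} (hH : 0 < H) (hξ : Tendsto ξ l atTop)
    (hup : ∀ η : ℝ, 0 < η → ∀ᶠ n in l, P n ≤ 2 * Real.exp (-((1 - η) * ξ n ^ 2 / (2 * H))))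
    (hlo : ∀ η : ℝ, 0 < η → ∀ᶠ n in l, Real.exp (-((1 + η) * ξ n ^ 2 / (2 * H))) ≤ P n) :
    Tendsto (fun n => Real.log (P n) / ξ n ^ 2) l (𝓝 (-(1 / (2 * H)))) := by
  rw [Metric.tendsto_nhds]
  intro ε hε
  have hη : 0 < ε * H := by positivity
  have hξ1 : ∀ᶠ n in l, 1 ≤ ξ n := hξ.eventually (eventually_ge_atTop 1)
  -- eventually `log 2 ≤ (ε/2) ξ²`
  have hξ2 : ∀ᶠ n in l, Real.log 2 ≤ ε / 2 * ξ n ^ 2 := by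
    have : Tendsto (fun n => ε / 2 * ξ n ^ 2) l atTop :=
      ((tendsto_pow_atTop two_ne_zero).comp hξ).const_mul_atTop (by positivity)
    exact this.eventually (eventually_ge_atTop _)
  filter_upwards [hup (ε * H / 2) (by positivity), hlo (ε * H) hη, hξ1, hξ2] with n hu hl' h1 h2
  have hξ2 : 0 < ξ n ^ 2 := by positivity
  have hP : 0 < P n := lt_of_lt_of_le (Real.exp_pos _) hl'
  have hlogu : Real.log (P n) ≤ Real.log 2 - (1 - ε * H / 2) * ξ n ^ 2 / (2 * H) := by
    have := Real.log_le_log hP hu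
    rwa [Real.log_mul (by norm_num) (Real.exp_pos _).ne', Real.log_exp] at this
  have hlogl : -((1 + ε * H) * ξ n ^ 2 / (2 * H)) ≤ Real.log (P n) := by
    have := Real.log_le_log (Real.exp_pos _) hl'; rwa [Real.log_exp] at this
  rw [Real.dist_eq, abs_lt]
  constructor
  · have : -(1 / (2 * H)) - ε < Real.log (P n) / ξ n ^ 2 := by
      rw [lt_div_iff₀ hξ2]
      have e : (-(1 / (2 * H)) - ε) * ξ n ^ 2 = -((1 + 2 * (ε * H)) * ξ n ^ 2 / (2 * H)) := by field_simp; ring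
      rw [e]
      refine lt_of_lt_of_le ?_ hlogl
      have : (1 + ε * H) * ξ n ^ 2 / (2 * H) < (1 + 2 * (ε * H)) * ξ n ^ 2 / (2 * H) :=
        div_lt_div_of_pos_right (mul_lt_mul_of_pos_right (by linarith) hξ2) (by positivity)
      linarith
    linarith
  · have : Real.log (P n) / ξ n ^ 2 < -(1 / (2 * H)) + ε := by
      rw [div_lt_iff₀ hξ2]
      have e : (-(1 / (2 * H)) + ε) * ξ n ^ 2 = ε / 2 * ξ n ^ 2 + (-((1 - 2 * (ε * H / 2)) * ξ n ^ 2 / (2 * H))) := by field_simp; ring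
      rw [e]
      refine lt_of_le_of_lt hlogu ?_
      have : (1 - 2 * (ε * H / 2)) * ξ n ^ 2 / (2 * H) < (1 - ε * H / 2) * ξ n ^ 2 / (2 * H) :=
        div_lt_div_of_pos_right (mul_lt_mul_of_pos_right (by linarith) hξ2) (by positivity)
      linarith
    linarith

open Classical in
/-- ★★ **THE TWO-SIDED MODERATE DEVIATION PRINCIPLE**: under UQE with curvature `H > 0` (nonnegative weights of positive mass, `a_n > 0`), for every
`ξ_n → ∞` with `ξ_n/a_n → 0`: `ξ_n^{-2} · log P_n(|X_n − c_n| ≥ ξ_n a_n) → −1/(2H)`, where `P_n(|X_n − c_n| ≥ ξ a) = P_n(X ≥ c + ξa) + P_n(X ≤ c − ξa)`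
is written as the sum of the two one-sided tails. [cite: DemboZeitouni2010, §3.7 Theorem 3.7.1 (moderate deviations; lane statement)] -/
theorem tendsto_log_twoSidedTail_div_sq_of_uqe (hH : 0 < H) (hw : ∀ᶠ n in l, ∀ i ∈ S n, 0 ≤ w n i)
    (hZ : ∀ᶠ n in l, 0 < ∑ i ∈ S n, w n i) (ha : ∀ᶠ n in l, 0 < a n)
    (hU : ∀ η : ℝ, 0 < η → ∃ δ : ℝ, 0 < δ ∧ ∀ᶠ n in l, ∀ s : ℝ, |s| ≤ δ * a n →
      |Real.log ((∑ i ∈ S n, w n i * Real.exp (s / a n * X n i)) / ∑ i ∈ S n, w n i) - s * c n / a n - H * s ^ 2 / 2| ≤ η * s ^ 2 + η)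
    {ξ : α → ℝ} (hξ : Tendsto ξ l atTop) (hξa : Tendsto (fun n => ξ n / a n) l (𝓝 0)) :
    Tendsto (fun n => Real.log (((∑ i ∈ (S n).filter (fun i => c n + ξ n * a n ≤ X n i), w n i)
        + ∑ i ∈ (S n).filter (fun i => X n i ≤ c n - ξ n * a n), w n i) / (∑ i ∈ S n, w n i)) / ξ n ^ 2) l (𝓝 (-(1 / (2 * H)))) := by
  refine tendsto_log_div_sq_of_squeeze_two H hH hξ (fun η hη => ?_) (fun η hη => ?_)
  · filter_upwards [eventually_upperTail_le_exp_of_uqe S w X a c H hH hw hZ ha hU hξ hξa hη,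
      eventually_lowerTail_le_exp_of_uqe S w X a c H hH hw hZ ha hU hξ hξa hη] with n h1 h2
    rw [add_div]
    linarith
  · filter_upwards [eventually_exp_le_upperTail_of_uqe S w X a c H hH hw hZ ha hU hξ hξa hη, hw, hZ] with n h1 hwn hZn
    rw [add_div]
    have h0 : 0 ≤ (∑ i ∈ (S n).filter (fun i => X n i ≤ c n - ξ n * a n), w n i) / ∑ i ∈ S n, w n i :=
      div_nonneg (Finset.sum_nonneg fun i hi => hwn i (Finset.mem_filter.1 hi).1) hZn.le
    linarith

end TwoSided

end Literature.Probability.Moments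

end
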